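import Summits.HodgeConjecture.HodgeConjecture.Theorems.F0P2pK1wLetterOfN1                      -- ★ p832032: `isConstituentOf_of_weylData`'s interface (files 1–4 of the K1w pay-down)
import Summits.HodgeConjecture.HodgeConjecture.Theorems.F0P3U3PrincipalSeriesJacquetFiltrationHolds  -- ★ p832625: N1 `U3PrincipalSeriesJacquetFiltration_holds` (hypothesis-free)
import Summits.HodgeConjecture.HodgeConjecture.Theorems.F0P3KeysLabelledPair                      -- ★ p833040: R1 `cmWeylTorusCharPair_ne_cmXiTorusChar`
import Literature.NumberTheory.Automorphic.JacquetRankStrictMono                                  -- ★ strict monotonicity of `r` along chains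
import Literature.NumberTheory.Automorphic.JacquetLengthTwoLabels                                 -- ★ `jacquetMap_equiv_injective`
import Literature.NumberTheory.Rogawski1990.KeysCaseTwoReducibleUnfold                            -- ★ p831448: N4 as a theorem-world `Iff`
import HarnessLib

/-!
# Crux `H413`, T3 «KeysCaseTwo» line, node K5c: Casselman's irreducibility criterion, easy direction — if every composition
# `i_G(χ) → i_G(wχ) → i_G(χ)` of intertwining maps vanishes then `i_G(χ)` is reducible; N4 `KeysCaseTwoReducible` from the vanishing at `χ_ξ`

Cell hodgecm-mathlib (D-0151), FLOOR 0, crux item H413 = stmt-HodgeConjecture-24833; T3 line `Cruxes/H413/Lines/F0_P3_KeysCaseTwoPaydown.lean`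
(letter N4 = ★ `Rogawski1990.KeysCaseTwoReducible`, [Keys1984, §7 Thm. (2)]), node K5c of `F0/P3/T3b-TREE.md` §1.  HONEST LABEL: HC_CM is proved only
modulo the printed citations until rung 0 closes; nothing here proves N4 — this file REDUCES it to the vanishing of the compositions of intertwining
operators at `χ_ξ` (Keys' `γ(χ_ξ) = 0`, [Keys1984, §5 Thm. (2), §7]; node K5e), theorems only, no definition, no `sorry`.

THE MATHEMATICS ([Casselman1995, §6.4, Thm. 6.6.2, §7.1]; [Keys1984, §7 p. 126 «By Theorem 6.6.2 of [1] … the non-unitary principal series is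
reducible iff `γ_m(wλ,−s)γ_m(λ,s)` is zero»]).  For a REGULAR character `χ ≠ wχ` of the diagonal torus `T` of `G = U(Φ₃)(L⁺_v)` (`v` non-split),
the Jacquet filtrations (★ N1 at `χ` and at `wχ`, `w² = 1`) and Frobenius give NON-ZERO intertwining operators `A : i(χ) → i(wχ)`, `B : i(wχ) → i(χ)`
(★ `F0P2pEigenlineFunctionals.exists_intertwiningMap_character_of_line` + ★ `F0P2pCmPrincipalSeriesInterface.exists_intertwiningMap_cmPrincipalSeries_ne_zero`,
the apparatus of the K1w pay-down).  If `i(χ)` were irreducible, `A` would be injective, so `range A ≅ i(χ)` has a TWO-dimensional Jacquet module;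
but `B ∘ A = 0` puts `range A ≤ ker B < ⊤`, and ★ strict monotonicity of the Jacquet functor along chains of subrepresentations of `i(wχ)` (every
constituent of `i(wχ)` has a non-zero Jacquet module: ★ N6 `u3_isSupercuspidal_iff_jacquet_eq_zero_holds` + ★ projectivity, read through ★
`not_subsingleton_coinvariants_of_isConstituentOf_cmPrincipalSeries`) forces `dim r(range A) < dim r(i(wχ)) = 2` — contradiction.  Hence:
«all compositions `B ∘ A` vanish ⇒ `i(χ)` reducible» (the direction «`γ(χ) = 0 ⇒` reducible» of Thm. 6.6.2; the converse is NOT claimed — in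
this def-free packaging it fails for a semisimple reducible `i(χ)`).

* §1 `reducible_of_forall_comp_eq_zero` — the criterion over an ABSTRACT pair `I, I'` with the interface of ★ `isConstituentOf_of_weylData`
  (Frobenius in existence form, the two Jacquet filtrations, «every constituent of `I'` has `r ≠ 0`»), generic group `G` and parabolic triple with
  commutative Levi; consumers instantiate it syntactically at their own spelling of the principal series.
* §2 `cmPrincipalSeries_reducible_of_forall_comp_eq_zero` — the instance `I = i_G(χ₁, χ₂)`, `I' = i_G(χ̄₁⁻¹, χ₂)` at a non-split `v`, continuous
  `χ₁, χ₂`, `χ ≠ wχ`; all inputs ★ and hypothesis-free (N1 p832625, N6 p831380, the K1w interface p829948).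
* §3 `cmPrincipalSeries_xi_reducible_of_forall_comp_eq_zero` — at `χ_ξ = cmXiTorusChar L v μ η₁ η₂` (regularity = ★ R1 p833040), and
  `keysCaseTwoReducible_of_forall_comp_eq_zero` — **N4 `KeysCaseTwoReducible L` from the vanishing of all compositions at every `χ_ξ`** (the
  remaining input is exactly Keys' `c`-function statement `γ(χ_ξ) = 0`, [Keys1984, §5 Thm. (2) (a)(b)(d), §7]).

## References
* [Casselman1995] W. Casselman, *Introduction to the theory of admissible representations of `p`-adic reductive groups* (draft 1 May 1995):
  Prop. 6.4.1 p. 62, §6.4 pp. 62–64, Thm. 6.6.2 p. 66, L. 7.1.1 (a), Cor. 7.1.2 p. 67, Thm. 3.2.4, Prop. 3.2.3.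
* [Keys1984] D. Keys, Compositio Math. 51 (1984), §5 Thm. (2), §7 Thm. (2) p. 126.  * [Rogawski1990] §12.2 (2) pp. 173–174.
* [BernsteinZelevinsky1977] Prop. 1.9, §2.12, Thm. 2.9.
-/

set_option autoImplicit false
-- the mandated namespace has the single-problem summit's repeated segment (`HodgeConjecture.HodgeConjecture`)
set_option linter.dupNamespace false

noncomputable section

open NumberField IsDedekindDomain MeasureTheory
open scoped Matrix

open Literature.NumberTheory Literature.NumberTheory.Automorphic Literature.NumberTheory.Automorphic.UnitaryGroup
open Literature.NumberTheory.Rogawski1990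
open Literature.RepresentationTheory.FiniteGroups Literature.RepresentationTheory.Semisimple

namespace Summit.HodgeConjecture.HodgeConjecture.Cruxes.H413.F0P3ReducibleOfIntertwiningCompositionZero

open F0P2pTorusPairsAndVacuity F0P2pCmPrincipalSeriesInterface F0P2pEigenlineFunctionals

universe u

/-! ## §1 The criterion over an abstract pair `I ≅ i(χ)`, `I' ≅ i(χ')` -/

section Abstract

variable {G : Type u} [Group G] [TopologicalSpace G] [IsTopologicalGroup G] (t : ParabolicTriple G) [LocallyCompactSpace t.P]

/-- **[Casselman1995, Thm. 6.6.2], easy direction, abstract form: all compositions `I → I' → I` vanish ⇒ `I` is reducible.**  Here `t = (P, M, N)`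
has COMMUTATIVE Levi `M` and `N` a limit of compact open subgroups; `χ ≠ χ'` are characters of `M`; `I`, `I'` (the latter smooth) stand for `i(χ)`, `i(χ')` with
exactly the interface of ★ `F0P2pWeylConstituentsRankOne.isConstituentOf_of_weylData`: Frobenius in existence form both ways, the two Jacquet filtrations
(`r I` two-dimensional with a `χ'`-line and quotient `χ`; `r I'` with a `χ`-line and quotient `χ'`) and «every constituent of `I'` has a non-zero Jacquet
module».  If every composition `B ∘ A` of `G`-maps `A : I → I'`, `B : I' → I` is zero, then `I` has a `G`-stable subspace `⊥ ≠ N ≠ ⊤`.  (Non-zero `A`, `B`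
exist — ★ `exists_intertwiningMap_character_of_line` and Frobenius; were `I` irreducible, `A` would be injective with `range A ≤ ker B < ⊤`, so
`dim r(range A) < dim r(I') = 2` by ★ `finrank_map_coinvariantsMk_lt_of_lt`, while `range A ≅ I` has `dim r = 2`.)  The converse is not claimed.
[cite: Casselman1995, Thm. 6.6.2 p. 66; §6.4 pp. 62–64; Prop. 6.4.1 p. 62; Cor. 7.1.2 p. 67] [cite: Keys1984, §7 p. 126] -/
theorem reducible_of_forall_comp_eq_zero (hN : IsLimitOfCompactOpen t.N) (hcomm : ∀ m m' : ↥t.M, m * m' = m' * m)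
    (χ χ' : ↥t.M →* ℂˣ) (hne : χ ≠ χ')
    {V V' : Type} [AddCommGroup V] [Module ℂ V] [AddCommGroup V'] [Module ℂ V']
    (I : Representation ℂ G V) (I' : Representation ℂ G V') (hsm' : I'.IsSmooth)
    (hFrob : ∀ φ : (I'.normalizedJacquet t).IntertwiningMap ((Representation.trivial ℂ ↥t.M ℂ).twist χ), φ ≠ 0 →
      ∃ B : I'.IntertwiningMap I, B ≠ 0)
    (hFrob' : ∀ φ : (I.normalizedJacquet t).IntertwiningMap ((Representation.trivial ℂ ↥t.M ℂ).twist χ'), φ ≠ 0 →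
      ∃ A : I.IntertwiningMap I', A ≠ 0)
    (hJ : FiniteDimensional ℂ (t.restrict I).Coinvariants ∧ Module.finrank ℂ (t.restrict I).Coinvariants = 2 ∧
      ∃ ℓ : Submodule ℂ (t.restrict I).Coinvariants, Module.finrank ℂ ↥ℓ = 1 ∧
        (∀ (m : ↥t.M), ∀ x ∈ ℓ, I.normalizedJacquet t m x = ((χ' m : ℂˣ) : ℂ) • x) ∧
        (∀ (m : ↥t.M) x, I.normalizedJacquet t m x - ((χ m : ℂˣ) : ℂ) • x ∈ ℓ))
    (hJ' : FiniteDimensional ℂ (t.restrict I').Coinvariants ∧ Module.finrank ℂ (t.restrict I').Coinvariants = 2 ∧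
      ∃ ℓ : Submodule ℂ (t.restrict I').Coinvariants, Module.finrank ℂ ↥ℓ = 1 ∧
        (∀ (m : ↥t.M), ∀ x ∈ ℓ, I'.normalizedJacquet t m x = ((χ m : ℂˣ) : ℂ) • x) ∧
        (∀ (m : ↥t.M) x, I'.normalizedJacquet t m x - ((χ' m : ℂˣ) : ℂ) • x ∈ ℓ))
    (hJH' : ∀ c : IrrClass G, c.IsConstituentOf I' → ∃ r : SmoothIrrep G, IrrClass.mk r = c ∧ Nontrivial (t.restrict r.ρ).Coinvariants)
    (h0 : ∀ (A : I.IntertwiningMap I') (B : I'.IntertwiningMap I), B.comp A = 0) :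
    ∃ N : Subrepresentation I, N ≠ ⊥ ∧ N ≠ ⊤ := by
  obtain ⟨hfd, hX2, ℓ, hℓ1, hℓχ', hqχ⟩ := hJ
  obtain ⟨hfd', hX2', ℓ', hℓ'1, hℓ'χ, hqχ'⟩ := hJ'
  -- Step 1: non-zero `A : I → I'` and `B : I' → I` (eigen-line functionals + Frobenius)
  obtain ⟨φB, hφB⟩ := exists_intertwiningMap_character_of_line hcomm _ χ χ' hne ℓ' hℓ'1 hℓ'χ hqχ'
  obtain ⟨φA, hφA⟩ := exists_intertwiningMap_character_of_line hcomm _ χ' χ hne.symm ℓ hℓ1 hℓχ' hqχ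
  obtain ⟨B, hB⟩ := hFrob φB hφB
  obtain ⟨A, hA⟩ := hFrob' φA hφA
  have hcomp : B.comp A = 0 := h0 A B
  -- Step 2: suppose `I` has no `G`-stable subspace other than `⊥`, `⊤`
  by_contra hirr
  push Not at hirr
  -- `A` is injective
  have hker : A.ker = ⊥ := by
    by_contra hk
    have htop : A.ker = ⊤ := hirr _ hk
    apply hA
    refine Representation.IntertwiningMap.ext (LinearMap.ext fun x => ?_)
    have hx : x ∈ A.ker := by rw [htop]; trivial
    rw [Representation.IntertwiningMap.mem_ker] at hx
    simpa using hx
  have hinj : Function.Injective A := by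
    have h' : LinearMap.ker A.toLinearMap = ⊥ := by
      have := congrArg Subrepresentation.toSubmodule hker
      rw [Representation.IntertwiningMap.ker_toSubmodule] at this
      exact this
    exact LinearMap.ker_eq_bot.mp h'
  -- `range A ≤ ker B < ⊤`
  have hle : A.range ≤ B.ker := by
    intro y hy
    rw [Representation.IntertwiningMap.mem_range] at hy
    obtain ⟨x, rfl⟩ := hy
    rw [Representation.IntertwiningMap.mem_ker]
    have := congrArg (fun T : I.IntertwiningMap I => T x) hcomp
    simpa using this
  have hK : B.ker ≠ ⊤ := by
    intro htop
    apply hB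
    refine Representation.IntertwiningMap.ext (LinearMap.ext fun y => ?_)
    have hy : y ∈ B.ker := by rw [htop]; trivial
    rw [Representation.IntertwiningMap.mem_ker] at hy
    simpa using hy
  have hlt : A.range < ⊤ := lt_of_le_of_lt hle (lt_top_iff_ne_top.mpr hK)
  -- Step 3: strict monotonicity in `r(I')`: `dim (image of range A) < dim (image of ⊤) ≤ 2`
  haveI := hfd
  haveI := hfd'
  have hlt' := Representation.finrank_map_coinvariantsMk_lt_of_lt t hN hsm' hJH' hlt
  have htop' : Module.finrank ℂ ↥((⊤ : Subrepresentation I').toSubmodule.map (Representation.Coinvariants.mk (t.restrict I'))) ≤ 2 :=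
    hX2' ▸ Submodule.finrank_le _
  -- Step 4: but `range A ≅ I` has a two-dimensional Jacquet module
  have heq : Module.finrank ℂ ↥(A.range.toSubmodule.map (Representation.Coinvariants.mk (t.restrict I'))) = 2 := by
    rw [← Representation.finrank_coinvariants_toRepresentation_eq t hN hsm' A.range]
    let eV : V ≃ₗ[ℂ] ↥A.range.toSubmodule := LinearEquiv.ofInjective A.toLinearMap hinj
    have heV : ∀ x, ((eV x : ↥A.range.toSubmodule) : V') = A x := fun x => rfl
    have e : I.Equiv A.range.toRepresentation :=
      Representation.Equiv.mk eV fun g => by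
        refine LinearMap.ext fun x => Subtype.ext ?_
        simp only [LinearMap.coe_comp, Function.comp_apply, LinearEquiv.coe_coe,
          Subrepresentation.toRepresentation_apply_coe, heV]
        exact _root_.Representation.IntertwiningMap.isIntertwining I I' A g x
    haveI hfdR : FiniteDimensional ℂ (t.restrict A.range.toRepresentation).Coinvariants :=
      Module.Finite.of_injective (Representation.jacquetMap t e.symm.toIntertwiningMap).toLinearMap
        (IrrClass.jacquetMap_equiv_injective t e.symm)
    apply le_antisymm
    · calc Module.finrank ℂ (t.restrict A.range.toRepresentation).Coinvariants
          ≤ Module.finrank ℂ (t.restrict I).Coinvariants :=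
            LinearMap.finrank_le_finrank_of_injective
              (f := (Representation.jacquetMap t e.symm.toIntertwiningMap).toLinearMap) (IrrClass.jacquetMap_equiv_injective t e.symm)
        _ = 2 := hX2
    · calc 2 = Module.finrank ℂ (t.restrict I).Coinvariants := hX2.symm
        _ ≤ Module.finrank ℂ (t.restrict A.range.toRepresentation).Coinvariants :=
            LinearMap.finrank_le_finrank_of_injective
              (f := (Representation.jacquetMap t e.toIntertwiningMap).toLinearMap) (IrrClass.jacquetMap_equiv_injective t e)
  omega

end Abstract

/-! ## §2 The instance `I = i_G(χ₁, χ₂)`, `I' = i_G(χ̄₁⁻¹, χ₂)` at a non-split place -/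

section CM

variable (L : Type) [Field L] [NumberField L] [IsCMField L] (v : HeightOneSpectrum (𝓞 ↥(maximalRealSubfield L)))

set_option synthInstance.maxHeartbeats 400000 in
set_option maxHeartbeats 8000000 in
/-- **`i_G(χ)` IS REDUCIBLE IF ALL COMPOSITIONS `i_G(χ) → i_G(wχ) → i_G(χ)` VANISH** (`G = U(Φ₃)(L⁺_v)`, `v` non-split, `χ = (χ₁, χ₂)` continuous and
REGULAR: `χ ≠ wχ = (χ̄₁⁻¹, χ₂)`, the latter spelled ★ `cmTorusCharPair L v (conjInvChar σ χ₁) χ₂` = ★ `cmWeylTorusCharPair L v χ₁ χ₂` by `rfl`).  §1 at the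
two principal series, fed with ★ N1 (p832625, hypothesis-free) at `(χ₁, χ₂)` and at `(χ̄₁⁻¹, χ₂)` (`w² = 1` on the second line character, ★
`conjInvChar_conjInvChar`), the Frobenius existence form ★ `exists_intertwiningMap_cmPrincipalSeries_ne_zero`, commutativity of `T` (★ `torusU_mul_comm`),
★ `isLimitOfCompactOpen_cmBorelTriple_N`, and «no constituent of `i_G(wχ)` has zero Jacquet module» (★ N6 `u3_isSupercuspidal_iff_jacquet_eq_zero_holds` through
★ `not_subsingleton_coinvariants_of_isConstituentOf_cmPrincipalSeries`).  [Casselman1995, Thm. 6.6.2] direction «`γ(χ) = 0 ⇒ i(χ)` reducible».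
[cite: Casselman1995, Thm. 6.6.2 p. 66; §6.4 pp. 62–64; §7.1 p. 67] [cite: Rogawski1990, §12.2 p. 173] -/
theorem cmPrincipalSeries_reducible_of_forall_comp_eq_zero
    (hns : ∀ w : PlacesOver L v, IsCMField.complexConj L • w.1 = w.1)
    (χ₁ : (LocalRing L v)ˣ →* ℂˣ) (χ₂ : ↥(normOneUnits (conjLocal L (IsCMField.complexConj L) v)) →* ℂˣ)
    (h₁ : Continuous fun x => ((χ₁ x : ℂˣ) : ℂ)) (h₂ : Continuous fun x => ((χ₂ x : ℂˣ) : ℂ))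
    (hreg : cmTorusCharPair L v χ₁ χ₂ ≠ cmTorusCharPair L v (conjInvChar (conjLocal L (IsCMField.complexConj L) v) χ₁) χ₂)
    (h0 : ∀ (A : (cmPrincipalSeries L 3 v (cmTorusCharPair L v χ₁ χ₂)).IntertwiningMap
          (cmPrincipalSeries L 3 v (cmTorusCharPair L v (conjInvChar (conjLocal L (IsCMField.complexConj L) v) χ₁) χ₂)))
        (B : (cmPrincipalSeries L 3 v (cmTorusCharPair L v (conjInvChar (conjLocal L (IsCMField.complexConj L) v) χ₁) χ₂)).IntertwiningMap
          (cmPrincipalSeries L 3 v (cmTorusCharPair L v χ₁ χ₂))), B.comp A = 0) :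
    ∃ N : Subrepresentation (cmPrincipalSeries L 3 v (cmTorusCharPair L v χ₁ χ₂)), N ≠ ⊥ ∧ N ≠ ⊤ := by
  haveI := locallyCompactSpace_cmBorelU L 3 v
  have hww : cmWeylTorusCharPair L v (conjInvChar (conjLocal L (IsCMField.complexConj L) v) χ₁) χ₂ = cmTorusCharPair L v χ₁ χ₂ := by
    rw [cmWeylTorusCharPair_eq, conjInvChar_conjInvChar _ (conjLocal_conjLocal_cm L v)]
  have h₁' : Continuous fun x => ((conjInvChar (conjLocal L (IsCMField.complexConj L) v) χ₁ x : ℂˣ) : ℂ) :=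
    continuous_coe_conjInvChar _ (continuous_conjLocal L (IsCMField.complexConj L) v) χ₁ h₁
  -- the two Jacquet filtrations (★ N1, hypothesis-free, through its theorem-world bridge), line characters respelled
  obtain ⟨hfd, hX2, ℓ, hℓ1, hline, hquot⟩ := (UnitaryGroup.U3PrincipalSeriesJacquetFiltration_iff L).1
    (F0P3U3PrincipalSeriesJacquetFiltrationHolds.U3PrincipalSeriesJacquetFiltration_holds L) v hns χ₁ χ₂ h₁ h₂
  obtain ⟨hfd', hX2', ℓ', hℓ'1, hline', hquot'⟩ := (UnitaryGroup.U3PrincipalSeriesJacquetFiltration_iff L).1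
    (F0P3U3PrincipalSeriesJacquetFiltrationHolds.U3PrincipalSeriesJacquetFiltration_holds L) v hns
    (conjInvChar (conjLocal L (IsCMField.complexConj L) v) χ₁) χ₂ h₁' h₂
  have hline₁ := fun m x hx => (hline m x hx).trans (by rw [cmWeylTorusCharPair_eq])
  have hline₂ := fun m x hx => (hline' m x hx).trans (by rw [hww])
  exact reducible_of_forall_comp_eq_zero (cmBorelTriple L 3 v) (isLimitOfCompactOpen_cmBorelTriple_N L 3 v)
    (UnitaryGroup.torusU_mul_comm _ _) (cmTorusCharPair L v χ₁ χ₂)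
    (cmTorusCharPair L v (conjInvChar (conjLocal L (IsCMField.complexConj L) v) χ₁) χ₂) hreg
    (cmPrincipalSeries L 3 v (cmTorusCharPair L v χ₁ χ₂))
    (cmPrincipalSeries L 3 v (cmTorusCharPair L v (conjInvChar (conjLocal L (IsCMField.complexConj L) v) χ₁) χ₂))
    (isSmooth_cmPrincipalSeries L v _)
    (fun φ hφ => exists_intertwiningMap_cmPrincipalSeries_ne_zero L v _ _ (isSmooth_cmPrincipalSeries L v _) φ hφ)
    (fun φ hφ => exists_intertwiningMap_cmPrincipalSeries_ne_zero L v _ _ (isSmooth_cmPrincipalSeries L v _) φ hφ)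
    ⟨hfd, hX2, ℓ, hℓ1, hline₁, hquot⟩ ⟨hfd', hX2', ℓ', hℓ'1, hline₂, hquot'⟩
    (fun c hc => by
      obtain ⟨r, rfl⟩ := IrrClass.mk_surjective c
      exact ⟨r, rfl, not_subsingleton_iff_nontrivial.mp fun h0 =>
        not_subsingleton_coinvariants_of_isConstituentOf_cmPrincipalSeries L v u3_isSupercuspidal_iff_jacquet_eq_zero_holds hns _ r hc h0⟩)
    h0

/-! ## §3 At `χ_ξ`: N4 `KeysCaseTwoReducible` from the vanishing of all compositions -/

set_option synthInstance.maxHeartbeats 400000 in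
set_option maxHeartbeats 8000000 in
/-- **`i_G(χ_ξ)` is reducible if all compositions `i_G(χ_ξ) → i_G(wχ_ξ) → i_G(χ_ξ)` vanish** (`χ_ξ = (η̃₁ μ ‖·‖^{1/2}, η₂)` = ★ `cmXiTorusChar L v μ η₁ η₂`,
`wχ_ξ = (χ̄_ξ,1⁻¹, η₂)` spelled ★ `cmTorusCharPair L v (conjInvChar σ χ_ξ,1) η₂`; `μ` extends `ω_{E/F}`, all characters continuous, `v` non-split):
§2 at `χ₁ = η̃₁ μ ‖·‖^{1/2}` (★ `cmXiTorusChar_eq_cmTorusCharPair`, `rfl`), regularity `χ_ξ ≠ wχ_ξ` = ★ R1 `F0P3KeysLabelledPair.cmWeylTorusCharPair_ne_cmXiTorusChar`,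
continuity of `χ_ξ,1` = ★ `continuous_cmXiTorusChar_fst`.  [Keys1984, §7]: «the kernel of `A(w, λ)` is an irreducible invariant subspace».
[cite: Keys1984, §7 Thm. (2) p. 126] [cite: Casselman1995, Thm. 6.6.2 p. 66] [cite: Rogawski1990, §12.2 (2) p. 173] -/
theorem cmPrincipalSeries_xi_reducible_of_forall_comp_eq_zero
    (hns : ∀ w : PlacesOver L v, IsCMField.complexConj L • w.1 = w.1)
    (μ : (LocalRing L v)ˣ →* ℂˣ) (η₁ η₂ : ↥(normOneUnits (conjLocal L (IsCMField.complexConj L) v)) →* ℂˣ)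
    (hμ : IsQuadraticCharExtension (conjLocal L (IsCMField.complexConj L) v) μ)
    (hμc : Continuous fun x => ((μ x : ℂˣ) : ℂ)) (h1c : Continuous fun x => ((η₁ x : ℂˣ) : ℂ)) (h2c : Continuous fun x => ((η₂ x : ℂˣ) : ℂ))
    (h0 : ∀ (A : (cmPrincipalSeries L 3 v (cmXiTorusChar L v μ η₁ η₂)).IntertwiningMap
          (cmPrincipalSeries L 3 v (cmTorusCharPair L v (conjInvChar (conjLocal L (IsCMField.complexConj L) v)
            (η₁.comp (quotConj (conjLocal L (IsCMField.complexConj L) v) (conjLocal_conjLocal_cm L v)) * μ *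
              halfModulusChar (LocalRing L v))) η₂)))
        (B : (cmPrincipalSeries L 3 v (cmTorusCharPair L v (conjInvChar (conjLocal L (IsCMField.complexConj L) v)
            (η₁.comp (quotConj (conjLocal L (IsCMField.complexConj L) v) (conjLocal_conjLocal_cm L v)) * μ *
              halfModulusChar (LocalRing L v))) η₂)).IntertwiningMap
          (cmPrincipalSeries L 3 v (cmXiTorusChar L v μ η₁ η₂))), B.comp A = 0) :
    ∃ N : Subrepresentation (cmPrincipalSeries L 3 v (cmXiTorusChar L v μ η₁ η₂)), N ≠ ⊥ ∧ N ≠ ⊤ := by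
  have hreg : cmTorusCharPair L v
        (η₁.comp (quotConj (conjLocal L (IsCMField.complexConj L) v) (conjLocal_conjLocal_cm L v)) * μ * halfModulusChar (LocalRing L v)) η₂ ≠
      cmTorusCharPair L v (conjInvChar (conjLocal L (IsCMField.complexConj L) v)
        (η₁.comp (quotConj (conjLocal L (IsCMField.complexConj L) v) (conjLocal_conjLocal_cm L v)) * μ * halfModulusChar (LocalRing L v))) η₂ :=
    fun h => F0P3KeysLabelledPair.cmWeylTorusCharPair_ne_cmXiTorusChar L v μ η₁ η₂ hμ
      ((cmWeylTorusCharPair_eq L v _ η₂).trans (h.symm.trans (cmXiTorusChar_eq_cmTorusCharPair L v μ η₁ η₂).symm))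
  exact cmPrincipalSeries_reducible_of_forall_comp_eq_zero L v hns _ η₂ (continuous_cmXiTorusChar_fst L v μ η₁ hμc h1c) h2c hreg h0

set_option synthInstance.maxHeartbeats 400000 in
set_option maxHeartbeats 8000000 in
/-- **N4 `KeysCaseTwoReducible L` FROM KEYS' VANISHING `γ(χ_ξ) = 0`** (node K5e of the T3b tree, in def-free form): if at every non-split `v` and every
case-two character `χ_ξ` every composition `i_G(χ_ξ) → i_G(wχ_ξ) → i_G(χ_ξ)` of intertwining maps is zero ([Keys1984, §5 Thm. (2) (a)(b)(d) + §7]: the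
normalising factor `γ_m(wλ, −s)γ_m(λ, s)` vanishes at the case-two point, and `Hom_G(i(χ), i(wχ))`, `Hom_G(i(wχ), i(χ))` are lines), then ★ N4 holds.
The hypothesis is the one analytic input of Keys' proof; everything else is ★ (§2–§3, through ★ `KeysCaseTwoReducible_iff`).
[cite: Keys1984, §7 Thm. (2) p. 126; §5 Thm. (2) pp. 124–125] [cite: Casselman1995, Thm. 6.6.2 p. 66] [cite: Rogawski1990, §12.2 (2) pp. 173–174] -/
theorem keysCaseTwoReducible_of_forall_comp_eq_zero
    (h0 : ∀ (v : HeightOneSpectrum (𝓞 ↥(maximalRealSubfield L))),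
      (∀ w : PlacesOver L v, IsCMField.complexConj L • w.1 = w.1) →
      ∀ (μ : (LocalRing L v)ˣ →* ℂˣ) (η₁ η₂ : ↥(normOneUnits (conjLocal L (IsCMField.complexConj L) v)) →* ℂˣ),
        IsQuadraticCharExtension (conjLocal L (IsCMField.complexConj L) v) μ →
        Continuous (fun x => ((μ x : ℂˣ) : ℂ)) → Continuous (fun x => ((η₁ x : ℂˣ) : ℂ)) → Continuous (fun x => ((η₂ x : ℂˣ) : ℂ)) →
      ∀ (A : (cmPrincipalSeries L 3 v (cmXiTorusChar L v μ η₁ η₂)).IntertwiningMap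
            (cmPrincipalSeries L 3 v (cmTorusCharPair L v (conjInvChar (conjLocal L (IsCMField.complexConj L) v)
              (η₁.comp (quotConj (conjLocal L (IsCMField.complexConj L) v) (conjLocal_conjLocal_cm L v)) * μ *
                halfModulusChar (LocalRing L v))) η₂)))
        (B : (cmPrincipalSeries L 3 v (cmTorusCharPair L v (conjInvChar (conjLocal L (IsCMField.complexConj L) v)
              (η₁.comp (quotConj (conjLocal L (IsCMField.complexConj L) v) (conjLocal_conjLocal_cm L v)) * μ *
                halfModulusChar (LocalRing L v))) η₂)).IntertwiningMap
            (cmPrincipalSeries L 3 v (cmXiTorusChar L v μ η₁ η₂))), B.comp A = 0) :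
    KeysCaseTwoReducible L :=
  (KeysCaseTwoReducible_iff L).2 fun v hns μ η₁ η₂ hμ hμc h1c h2c =>
    cmPrincipalSeries_xi_reducible_of_forall_comp_eq_zero L v hns μ η₁ η₂ hμ hμc h1c h2c (h0 v hns μ η₁ η₂ hμ hμc h1c h2c)

end CM

end Summit.HodgeConjecture.HodgeConjecture.Cruxes.H413.F0P3ReducibleOfIntertwiningCompositionZero

end
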